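import Summits.FinalStateConjecture.FinalStateConjecture.Theorems.NearExtremalKappaCapture.Negative.ExponentMonotonicity
import Literature.Geometry.Lorentzian.KerrSurfaceGravity
import Literature.Geometry.Lorentzian.KerrDataAsymptoticFlatness
import Literature.Geometry.Lorentzian.ADMEnergyPinning

/-!
# ADM pinning on the Kerr–Schild end (stub `stub_admPinning`, line area-excess-ratchet)

Crux `NearExtremalKappaCapture` (stmt-FinalStateConjecture-10606, route PhaseMixingCapture), law α₂
of the rev-2 skeleton: a datum `D` on the Kerr–Schild slice `Kerr.slice a M` at **finite** weighted
Sobolev distance `H^s_δ × H^{s-1}_{δ+1}` (`InitialDataSet.dataWeightedSobolevEDist`, `s ≥ 2`,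
`δ ≥ 2`) from the Kerr datum `Kerr.data M a M` has the same ADM energy `M` on the end
`Kerr.afEnd a M` as the Kerr datum (the latter granted as the named fact
`Kerr.hasADMEnergy_data M a M`).

The chart of the Kerr end is the identity (`Kerr.mfderiv_dataChart_afEnd_apply`), so its chart
components read the metric components verbatim (`hCoeff_afEnd_eq_hFun`) and the Literature
pinning theorem `AFEnd.hasADMEnergy_of_dataWeightedSobolevEDist_lt_top`
(`Literature/Geometry/Lorentzian/ADMEnergyPinning.lean`: the ADM field of `h_D − h_K` is an `L¹`
field with `L¹` divergence, whose flux through `S_r` tends to `0`; Bartnik, CPAM 39 (1986), §4,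
(4.2)–(4.4), Prop. 4.1, linearised) applies.

## References

* R. Bartnik, *The mass of an asymptotically flat manifold*, CPAM 39 (1986), §4, (4.2)–(4.4),
  Prop. 4.1, Thm. 4.2.
-/

noncomputable section

-- the stub is registered in the skeleton's namespace `Theorems.NearExtremalKappaCapture.…`,
-- which repeats the segment `FinalStateConjecture` of the tree path
set_option linter.dupNamespace false

namespace Summit.FinalStateConjecture.FinalStateConjecture.Theorems.NearExtremalKappaCapture.AreaExcessRatchet

open Literature.Geometry.Lorentzian
open Summit.FinalStateConjecture.FinalStateConjecture.Theorems.NearExtremalKappaCapture.Negative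
open scoped Manifold ContDiff Topology ENNReal
open Set Filter

/-- **The identity chart of the Kerr end reads the metric components verbatim**: for data `D` on
the Kerr–Schild slice and `‖z‖ > R`, `hCoeff (Kerr.afEnd a r₀) D z = hFun D z` (the inverse chart
has identity differential, `Kerr.mfderiv_dataChart_afEnd_apply`). Bartnik 1986, §1 (structure of
infinity). [cite: Bartnik1986CPAM, §1] -/
theorem hCoeff_afEnd_eq_hFun (a r₀ : ℝ) (D : InitialDataSet 𝓘(ℝ, E3) (Kerr.slice a r₀)) {z : E3}
    (hz : Kerr.afRadius a r₀ < ‖z‖) : AFEnd.hCoeff (Kerr.afEnd a r₀) D z = D.hFun z := by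
  have hz' : (Kerr.afEnd a r₀).R < ‖z‖ := hz
  ext v w
  have h := AFEnd.hCoeff_apply_eq_dataChart (Kerr.afEnd a r₀) D ⟨z, hz'⟩ v w
  rw [Kerr.mfderiv_dataChart_afEnd_apply, Kerr.mfderiv_dataChart_afEnd_apply] at h
  rw [InitialDataSet.hFun_of_mem D (Kerr.mem_slice_of_lt_norm hz)]
  exact h

/-- **S3 — `stub_admPinning` (law α₂: the basin pins the ADM energy).** With the threshold
`N₀ = 2`: for `s ≥ 2`, `δ ≥ 2`, every `M > 0` and every `a`, granted the named fact
`Kerr.hasADMEnergy_data M a M` (the ADM fluxes of the Kerr–Schild slice datum converge to `M`),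
every datum `D` on `Kerr.slice a M` at finite `H^s_δ × H^{s-1}_{δ+1}` distance from
`Kerr.data M a M` has ADM energy `M` on the end `Kerr.afEnd a M`. The chart of the Kerr end is the
identity (`hCoeff_afEnd_eq_hFun`) and `{‖x‖ > R} ⊆ Kerr.slice a M` (`Kerr.mem_slice_of_lt_norm`),
so this is `AFEnd.hasADMEnergy_of_dataWeightedSobolevEDist_lt_top`. (Sub-extremality, the vacuum
constraints and the Levi-Civita instance are not used.) Bartnik, CPAM 39 (1986), §4, (4.2)–(4.4),
Prop. 4.1. [cite: Bartnik1986CPAM, §4 (4.2)–(4.4), Prop. 4.1] -/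
theorem stub_admPinning [Kerr.Facts] [Kerr.SliceFacts] :
    ∃ N₀ : ℕ, ∀ (s : ℕ) (δ : ℝ), N₀ ≤ s → (N₀ : ℝ) ≤ δ →
      ∀ (M : ℝ) (hM : 0 < M) (a : ℝ), Kerr.IsSubextremal M a → Kerr.hasADMEnergy_data M a M →
        ∀ (D : InitialDataSet 𝓘(ℝ, E3) (Kerr.slice a M)) [D.metric.HasLeviCivita],
          D.IsVacuumConstraintSolution →
            InitialDataSet.dataWeightedSobolevEDist s δ D (Kerr.data M a M hM.le) < ⊤ →
              (Kerr.afEnd a M).HasADMEnergy D M := by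
  refine ⟨2, fun s δ hs hδ M hM a _ hK D _ _ hdist ↦ ?_⟩
  have hδ1 : (1 : ℝ) ≤ δ := by
    have h2 : ((2 : ℕ) : ℝ) ≤ δ := hδ
    push_cast at h2
    linarith
  exact (Kerr.afEnd a M).hasADMEnergy_of_dataWeightedSobolevEDist_lt_top
    (fun D' z hz ↦ hCoeff_afEnd_eq_hFun a M D' hz) (fun z hz ↦ Kerr.mem_slice_of_lt_norm hz)
    D (Kerr.data M a M hM.le) hs hδ1 hdist (hK hM.le)

end Summit.FinalStateConjecture.FinalStateConjecture.Theorems.NearExtremalKappaCapture.AreaExcessRatchet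

end
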